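import Literature.NumberTheory.EllipticCurves.SelmerGaloisActionLocal
import HarnessLib

/-!
# T1 JET (cell `bsd-jet`), road K, plumbing input `h𝒮σ` — FIRST BRICK: the local action `σ_*`
# carries the local Kummer class of `Q ∈ E(K̄_E)` to the local Kummer class of `Θ Q ∈ E(K̄_{E'})`

HONEST FRAMING (programme file §HONESTY, verbatim): «no tranche here proves BSD; ARM L moves the
LITERAL column of an r ≤ 1 census into the kernel-proved-modulo-named-print column.» THEOREMS ONLY
(seat `bsd-jet-pv-2`, session g4; `--supports stmt-BirchSwinnertonDyer-14418`, helper); 0 classes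
move; plumbing. WHAT THIS IS. The H63 line (`JET.tamagawaExponent_le_mInfty_of_localFacts`, p512962)
keeps the hypothesis `h𝒮σ`: the stringent family `JET.stringentFamily` (the connected Kummer
condition `δ_v(E₀(K_v))`, x11b3 `JetchevKummer.connectedKummerCondition`) is carried by the local
action `σ_* = conjActPlace` from `v` to `σ v`. Its proof has two halves: (i) `σ_*` maps the local
Kummer class `κ_E(Q)` (`localKummerClass`, the class `[g ↦ θ⁻¹(g Q − Q)]`) to `κ_{E'}(Θ Q)` for the
adapted lift `Θ : K̄_E ≃ K̄_{E'}` — THIS FILE (`localConjH1_localKummerClass`, in the generality of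
pv-1's `SelmerGaloisActionLocal`: any `σ`-semilinear `θ : E ≃+* E'` with adapted lifts); (ii) the
transport of `E₀` along the isomorphism of discretely valued fields `K_v ≃ K_{σv}` — the tree's
`hasNonsingularReduction_mapPoint_ringEquiv_iff` (`TamagawaRingEquivProofs`). The assembly of (i)+(ii)
into `h𝒮σ` is left to the successor (sheet PV2-J6-KERNEL ADDENDUM-4 §1). References:
[cite: SilvermanAEC2009, VIII.§2 (δ), X.§4 (**)] [cite: SerreGaloisCohomology1997, I.§2.4 (compatible
pairs)] [cite: Jetchev2008, §3.1 (p. 814), §5 Thm. 5.1].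
-/

set_option autoImplicit false

noncomputable section

open scoped Classical

open WeierstrassCurve Field Literature.NumberTheory.EllipticCurves
  Literature.NumberTheory.GaloisRepresentations

namespace Summit.BirchSwinnertonDyer.Rank1Residual.JET

universe u

variable {K : Type u} [Field K] [CharZero K] (W : WeierstrassCurve ℚ) [W.IsElliptic]
variable {E E' : Type u} [Field E] [Algebra K E] [Field E'] [Algebra K E'] [CharZero E] [CharZero E']
variable {σ : K ≃ₐ[ℚ] K} {τ : AlgebraicClosure K ≃+* AlgebraicClosure K} {θ : E ≃+* E'}
  {Θ : AlgebraicClosure E ≃+* AlgebraicClosure E'}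

omit [W.IsElliptic] in
/-- `n • Θ Q` is `Γ_{E'}`-fixed when `n • Q` is `Γ_E`-fixed (`Θ` intertwines `Θ⁻¹ g Θ` with `g`).
[cite: SerreGaloisCohomology1997, I.§2.4] -/
theorem zsmul_localPointsMap_mem_fixedPoints (hΘ : IsLiftOfRingEquiv θ Θ) (n : ℤ)
    {Q : localPoints (W.baseChange K) E}
    (hQ : n • Q ∈ MulAction.fixedPoints (absoluteGaloisGroup E) (localPoints (W.baseChange K) E)) :
    n • localPointsMap W Θ Q ∈
      MulAction.fixedPoints (absoluteGaloisGroup E') (localPoints (W.baseChange K) E') := fun g ↦ by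
  change g • (n • localPointsMap W Θ Q) = n • localPointsMap W Θ Q
  rw [← map_zsmul, ← hΘ.localPointsMap_smul, hQ]

/-- **`σ_*` carries local Kummer classes to local Kummer classes**: for adapted lifts `(τ, Θ)` of
`(σ, θ)` and `Q ∈ E(K̄_E)` with `n • Q ∈ E(E)`, the local action `localConjH1` maps the local Kummer
class `κ_E(Q) = [g ↦ θ⁻¹(gQ − Q)]` to `κ_{E'}(Θ Q)`. On cocycles: `τ (θ_E⁻¹((Θ⁻¹gΘ)Q − Q)) =
θ_{E'}⁻¹(g ΘQ − ΘQ)` by `Θ ∘ ι_E = ι_{E'} ∘ τ` (`LiftsCommute`) and `Θ((Θ⁻¹gΘ) Q) = g (Θ Q)`.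
With `E = K_v`, `E' = K_{σv}`: `σ_*(δ_v) = δ_{σv} ∘ θ_*`, the local form of the `Gal(K/ℚ)`-equivariance
of the Kummer map. [cite: SilvermanAEC2009, X.§4 (**)] [cite: SerreGaloisCohomology1997, I.§2.4] -/
theorem localConjH1_localKummerClass (hτ : IsLiftOfAut σ τ) (hΘ : IsLiftOfRingEquiv θ Θ)
    (hc : LiftsCommute τ Θ) {n : ℤ} (hn : n ≠ 0) (Q : localPoints (W.baseChange K) E)
    (hQ : n • Q ∈ MulAction.fixedPoints (absoluteGaloisGroup E) (localPoints (W.baseChange K) E)) :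
    localConjH1 W hτ hΘ hc n ((W.baseChange K).localKummerClass n hn Q hQ) =
      (W.baseChange K).localKummerClass n hn (localPointsMap W Θ Q)
        (zsmul_localPointsMap_mem_fixedPoints W hΘ n hQ) := by
  unfold WeierstrassCurve.localKummerClass
  rw [localConjH1_oneCocycleClass]
  congr 1
  apply Subtype.ext
  apply ContinuousMap.ext
  intro g
  rw [contOneCocycles.pullback_apply, localConjHom_hom_apply]
  -- compare in `E(K̄_{E'})` through the torsion comparison at `E'`
  apply ((W.baseChange K).torsionPointsEquiv n (E := E') hn).injective
  apply Subtype.ext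
  rw [coe_torsionPointsEquiv_apply, coe_torsionPointsEquiv_apply, IsLiftOfAut.coe_torsionMap,
    ← hc.localPointsMap_pointsMap W hτ, pointsMap_localKummerCocycle_apply,
    pointsMap_localKummerCocycle_apply, map_sub, hΘ.localPointsMap_smul]

end Summit.BirchSwinnertonDyer.Rank1Residual.JET

end
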